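import Literature.Geometry.Riemannian.SphericalCapNormal
import Literature.Geometry.Riemannian.MeanConvexContractibleProofs
import Literature.Geometry.Lorentzian.PseudoRiemannianMetricProofs
import Literature.Topology.FourManifolds.ClosedBallTangent
import Literature.Topology.FourManifolds.ClosedBallProofs
import Literature.Topology.FourManifolds.ClosedBallRadialCoordinate
import HarnessLib

/-!
# Sweeney 2026, Prop. 1.2 for the closed ball: `𝔻ⁿ⁺¹` carries a PSC metric with mean-convex boundary
(topic `Geometry/Riemannian`)

Third proof file of the named fact `Literature.Geometry.Riemannian.Sweeney2026_pscMeanConvex`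
(`MeanConvexContractible.lean`; P. Sweeney Jr., Math. Ann. (2026), Prop. 1.2, printed without
proof as a consequence of Lawson–Michelsohn, Invent. Math. 77 (1984): compact contractible
`(n+1)`-manifolds with boundary, Mazur if `n = 3`, carry metrics of positive scalar curvature with
mean-convex boundary). `MeanConvexContractibleProofs.lean` reduced the fact to a codimension-`0`
immersion into the round `Sⁿ⁺¹` under which the boundary is mean convex
(`pscMeanConvex_of_sphereImmersion`); this file PROVES that hypothesis, hence the full conclusion
of the fact, for the simplest compact contractible manifold, the closed unit ball `X = 𝔻ⁿ⁺¹`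
(`Topology/FourManifolds/ClosedBall.lean`) with an ARBITRARY boundary datum, for every `n ≥ 1`
(`pscMeanConvex_closedBall`): the `0`-handle base case of Lawson–Michelsohn's handle induction,
and the whole geometric content of the case `n = 2` of Prop. 1.2 (`X ≅ 𝔻³` by Perelman).

* `discCapMap n : 𝔻ⁿ⁺¹ → Sⁿ⁺¹ ⊆ ℝⁿ⁺²` — the gnomonic cap map of `SphericalCapMap.lean` (pole
  `e₀`) on the ball: smooth, `dΦ = d(capMap) ∘ Dι` injective (`ClosedBallTangent.lean`), image
  the closed cap of angular radius `π/4` about `-e₀`;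
* for a boundary datum `bX`: boundary points have norm `1`; boundary tangent vectors are tangent
  to the unit sphere (`inner_coe_incl_bdryVec`: differentiate `‖incl z‖² = 1`); `Φ ∘ incl` is a
  spacelike immersion for the round metric; the radial field `discNormal bX = N ∘ Φ ∘ incl`
  (`SphericalCapNormal.lean`) is a smooth unit normal field (`⟪2ρ⁻³(e x + e₀), ρ⁻¹ e ξ⟫ = 0`,
  `(2ρ⁻³)² · 2 = 1` as `ρ² = 2`), points outward (`(dΦ)⁻¹ ν = (Dι)⁻¹(2x)` has `0`-th chart
  coordinate `-⟪x, 2x⟫ = -2`, `ClosedBallRadialCoordinate.lean`), and is umbilic: `D_w ν = ∇_{d(Φ∘incl) w} N = d(Φ∘incl) w`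
  (`normalDerivAlong_discNormal`), so the second fundamental form IS the induced metric and the
  mean curvature is its metric trace, the dimension: `H = n` (`= n·cot(π/4)`, the mean curvature
  of a geodesic sphere of radius `π/4` in the unit `Sⁿ⁺¹`; Lee 2018, Example 8.25, Prop. 8.36);
* `pscMeanConvex_closedBall` — the conclusion of `Sweeney2026_pscMeanConvex` for `X = 𝔻ⁿ⁺¹`,
  `n ≥ 1`: pull back the round metric (scalar curvature `n(n+1) > 0`, boundary `H = n > 0`).

## References

* P. Sweeney Jr., *Positive curvature conditions on contractible manifolds*, Math. Ann. (2026)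
  = arXiv:2507.15719, Prop. 1.2 (p. 4). [Sweeney2026]
* H. B. Lawson, M.-L. Michelsohn, *Embedding and surrounding with positive mean curvature*,
  Invent. Math. 77 (1984) 399–419, Thm. 1. [LawsonMichelsohn1984]
* J. M. Lee, *Introduction to Riemannian Manifolds*, 2nd ed. (2018), Example 8.25, Prop. 8.36.
  [Lee2018]
-/

noncomputable section

open Bundle Set Function Metric Module Filter
open scoped Manifold ContDiff Topology RealInnerProductSpace

namespace Literature.Geometry.Riemannian

open Lorentzian Lorentzian.PseudoRiemannianMetric

/-! ### The closed ball `𝔻ⁿ⁺¹` mapped onto the spherical cap of angular radius `π/4` -/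

section Disc

open Literature.Topology.FourManifolds

variable (n : ℕ)

attribute [local instance] Literature.Topology.FourManifolds.fact_finrank_euclideanSpace_succ

/-- Local notation: the closed unit ball of `ℝⁿ⁺¹` with its manifold-with-boundary structure. -/
local notation "𝔻" => (Metric.closedBall (0 : EuclideanSpace ℝ (Fin (n + 1))) 1)

/-- Local notation: the ambient space `ℝⁿ⁺²` of the target sphere `Sⁿ⁺¹`. -/
local notation "𝕍" => EuclideanSpace ℝ (Fin (n + 1 + 1))

/-- **The disc-to-cap map** `𝔻ⁿ⁺¹ → Sⁿ⁺¹ ⊆ ℝⁿ⁺²`: the gnomonic cap map restricted to the closed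
unit ball (pole `e₀`); a smooth codimension-`0` immersion onto the closed spherical cap of angular
radius `π/4` about `-e₀`. [folklore] -/
def discCapMap (x : 𝔻) : sphere (0 : 𝕍) 1 :=
  capMap (n := n) (spherePole n) (x : EuclideanSpace ℝ (Fin (n + 1)))

/-- Unfolding lemma for `discCapMap`. [folklore] -/
theorem discCapMap_apply (x : 𝔻) :
    discCapMap n x = capMap (n := n) (spherePole n) (x : EuclideanSpace ℝ (Fin (n + 1))) := rfl

/-- The disc-to-cap map is smooth (cap map ∘ smooth inclusion `𝔻ⁿ⁺¹ ↪ ℝⁿ⁺¹`). [folklore] -/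
theorem contMDiff_discCapMap : ContMDiff (𝓡∂ (n + 1)) (𝓡 (n + 1)) ∞ (discCapMap n) :=
  (contMDiff_capMap (n := n) (spherePole n)).comp contMDiff_coe_closedBall

/-- Chain rule: `d(discCapMap)_x = d(capMap)_x ∘ Dι_x` (`mfderiv_coe_closedBall`). [folklore] -/
theorem mfderiv_discCapMap (x : 𝔻) :
    mfderiv (𝓡∂ (n + 1)) (𝓡 (n + 1)) (discCapMap n) x =
      (mfderiv 𝓘(ℝ, EuclideanSpace ℝ (Fin (n + 1))) (𝓡 (n + 1)) (capMap (n := n) (spherePole n))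
        (x : EuclideanSpace ℝ (Fin (n + 1)))).comp
      (closedBallCoeDeriv x : EuclideanSpace ℝ (Fin (n + 1)) →L[ℝ] EuclideanSpace ℝ (Fin (n + 1))) :=
  ((mdifferentiableAt_capMap (n := n) (spherePole n) _).hasMFDerivAt.comp x
    (hasMFDerivAt_coe_closedBall x)).mfderiv

/-- Pointwise form of `mfderiv_discCapMap`. [folklore] -/
theorem mfderiv_discCapMap_apply (x : 𝔻) (u : EuclideanSpace ℝ (Fin (n + 1))) :
    mfderiv (𝓡∂ (n + 1)) (𝓡 (n + 1)) (discCapMap n) x u =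
      mfderiv 𝓘(ℝ, EuclideanSpace ℝ (Fin (n + 1))) (𝓡 (n + 1)) (capMap (n := n) (spherePole n))
        (x : EuclideanSpace ℝ (Fin (n + 1))) (closedBallCoeDeriv x u) := by
  rw [mfderiv_discCapMap]
  rfl

/-- The disc-to-cap map is an immersion: its differentials are injective. [folklore] -/
theorem mfderiv_discCapMap_injective (x : 𝔻) :
    Injective (mfderiv (𝓡∂ (n + 1)) (𝓡 (n + 1)) (discCapMap n) x) := fun a b hab ↦
  (closedBallCoeDeriv x).injective (mfderiv_capMap_injective (n := n) (spherePole n) _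
    (by rwa [← mfderiv_discCapMap_apply, ← mfderiv_discCapMap_apply]))

/-- Hence (equal dimensions) its differentials are invertible. [folklore] -/
theorem isInvertible_mfderiv_discCapMap (x : 𝔻) :
    (mfderiv (𝓡∂ (n + 1)) (𝓡 (n + 1)) (discCapMap n) x).IsInvertible :=
  PseudoRiemannianMetric.isInvertible_mfderiv_of_injective rfl (mfderiv_discCapMap_injective n x)

variable {n}
variable (bX : BoundaryData (𝓡∂ (n + 1)) (Metric.closedBall (0 : EuclideanSpace ℝ (Fin (n + 1))) 1) (𝓡 n))

/-- On the boundary `ρ² = 2`, i.e. `ρ⁻² = 1/2`. [folklore] -/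
theorem inv_capRadius_incl_sq (z : bX.carrier) :
    (capRadius (n := n) ((bX.incl z : 𝔻) : EuclideanSpace ℝ (Fin (n + 1))))⁻¹ ^ 2 = 1 / 2 := by
  rw [inv_pow, capRadius_sq, norm_coe_boundaryData_incl, one_pow, one_add_one_eq_two, one_div]

/-- The disc-to-cap map takes values in the open hemisphere about `-e₀`. [folklore] -/
theorem inner_pole_discCapMap_neg (x : 𝔻) : ⟪((spherePole n : sphere (0 : 𝕍) 1) : 𝕍), discCapMap n x⟫ < 0 :=
  inner_pole_capMapAmb_neg _ _

/-- The inclusion of a boundary datum has injective differentials (it is an immersion). [folklore] -/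
theorem boundaryData_mfderiv_incl_injective (z : bX.carrier) : Injective (mfderiv (𝓡 n) (𝓡∂ (n + 1)) bX.incl z) :=
  Literature.Topology.FourManifolds.Manifold.IsImmersionAt.mfderiv_injective
    (bX.isSmoothEmbedding.isImmersion.isImmersionAt z) (by simp)

/-- `Φ ∘ incl` is smooth. [folklore] -/
theorem contMDiff_discCapMap_comp_incl : ContMDiff (𝓡 n) (𝓡 (n + 1)) ∞ (discCapMap n ∘ bX.incl) :=
  (contMDiff_discCapMap n).comp bX.isSmoothEmbedding.contMDiff

/-- `ξ = Dι (d incl w)`: the ambient representative of a boundary tangent vector. [folklore] -/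
def bdryVec (z : bX.carrier) (w : TangentSpace (𝓡 n) z) : EuclideanSpace ℝ (Fin (n + 1)) :=
  closedBallCoeDeriv (bX.incl z) (mfderiv (𝓡 n) (𝓡∂ (n + 1)) bX.incl z w)

/-- **Boundary tangent vectors are tangent to the unit sphere**: `ξ ⊥ incl z`. Differentiate
`‖incl z‖² = 1`. [folklore] -/
theorem inner_coe_incl_bdryVec (z : bX.carrier) (w : TangentSpace (𝓡 n) z) :
    ⟪((bX.incl z : 𝔻) : EuclideanSpace ℝ (Fin (n + 1))), bdryVec bX z w⟫ = 0 := by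
  set x : 𝔻 := bX.incl z with hx_def
  -- the map `z ↦ ‖incl z‖²` has derivative `2⟪x, Dι d(incl) w⟫` …
  have h1 : HasMFDerivAt (𝓡 n) 𝓘(ℝ, ℝ)
      (fun z : bX.carrier ↦ ‖((bX.incl z : 𝔻) : EuclideanSpace ℝ (Fin (n + 1)))‖ ^ 2) z
      ((2 • innerSL ℝ (x : EuclideanSpace ℝ (Fin (n + 1)))).comp
        ((closedBallCoeDeriv x : EuclideanSpace ℝ (Fin (n + 1)) →L[ℝ]
          EuclideanSpace ℝ (Fin (n + 1))).comp (mfderiv (𝓡 n) (𝓡∂ (n + 1)) bX.incl z))) :=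
    (hasStrictFDerivAt_norm_sq _).hasFDerivAt.hasMFDerivAt.comp z
      ((hasMFDerivAt_coe_closedBall x).comp z (bX.mdifferentiableAt_incl z).hasMFDerivAt)
  -- … and is constant
  have h2 : HasMFDerivAt (𝓡 n) 𝓘(ℝ, ℝ)
      (fun z : bX.carrier ↦ ‖((bX.incl z : 𝔻) : EuclideanSpace ℝ (Fin (n + 1)))‖ ^ 2) z
      (0 : TangentSpace (𝓡 n) z →L[ℝ] TangentSpace 𝓘(ℝ, ℝ)
        (‖((bX.incl z : 𝔻) : EuclideanSpace ℝ (Fin (n + 1)))‖ ^ 2)) := by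
    have hc : (fun z : bX.carrier ↦ ‖((bX.incl z : 𝔻) : EuclideanSpace ℝ (Fin (n + 1)))‖ ^ 2) =
        fun _ ↦ 1 := funext fun z ↦ by rw [norm_coe_boundaryData_incl bX z, one_pow]
    rw [hc]
    exact hasMFDerivAt_const 1 z
  have h := congrArg (fun L : TangentSpace (𝓡 n) z →L[ℝ] ℝ ↦ L w) (h1.mfderiv.symm.trans h2.mfderiv)
  simp only [ContinuousLinearMap.coe_comp, comp_apply, smul_apply, innerSL_apply_apply,
    nsmul_eq_mul, Nat.cast_ofNat] at h
  have h' : 2 * ⟪((bX.incl z : 𝔻) : EuclideanSpace ℝ (Fin (n + 1))), bdryVec bX z w⟫ = 0 := h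
  linarith

/-- Chain rule: `d(Φ ∘ incl) w = dΦ_cap (ξ)`. [folklore] -/
theorem mfderiv_discCapMap_comp_incl (z : bX.carrier) (w : TangentSpace (𝓡 n) z) :
    mfderiv (𝓡 n) (𝓡 (n + 1)) (discCapMap n ∘ bX.incl) z w =
      mfderiv 𝓘(ℝ, EuclideanSpace ℝ (Fin (n + 1))) (𝓡 (n + 1)) (capMap (n := n) (spherePole n))
        ((bX.incl z : 𝔻) : EuclideanSpace ℝ (Fin (n + 1))) (bdryVec bX z w) := by
  rw [mfderiv_comp z (((contMDiff_discCapMap n) _).mdifferentiableAt (by simp))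
    (bX.mdifferentiableAt_incl z)]
  exact mfderiv_discCapMap_apply n (bX.incl z) _

/-- The boundary tangent vectors read in `ℝⁿ⁺²`: `dι d(Φ ∘ incl) w = ρ⁻¹ e(ξ)`. [folklore] -/
theorem mvfderiv_coe_mfderiv_discCapMap_comp_incl (z : bX.carrier) (w : TangentSpace (𝓡 n) z) :
    mvfderiv (𝓡 (n + 1)) (Subtype.val : sphere (0 : 𝕍) 1 → 𝕍) (discCapMap n (bX.incl z))
        (mfderiv (𝓡 n) (𝓡 (n + 1)) (discCapMap n ∘ bX.incl) z w) =
      (capRadius (n := n) ((bX.incl z : 𝔻) : EuclideanSpace ℝ (Fin (n + 1))))⁻¹ •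
        capEmb (spherePole n) (bdryVec bX z w) := by
  rw [mfderiv_discCapMap_comp_incl, discCapMap_apply, mvfderiv_coe_mfderiv_capMap, capDeriv_apply,
    inner_coe_incl_bdryVec, mul_zero, zero_smul, sub_zero]

/-- Boundary tangent vectors, read in `ℝⁿ⁺²`, are orthogonal to the pole `e₀` (tangent to the parallel `⟪e₀, ·⟫ = -1/√2`). [folklore] -/
theorem inner_pole_mvfderiv_coe_mfderiv_discCapMap_comp_incl (z : bX.carrier)
    (w : TangentSpace (𝓡 n) z) :
    ⟪((spherePole n : sphere (0 : 𝕍) 1) : 𝕍), mvfderiv (𝓡 (n + 1))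
      (Subtype.val : sphere (0 : 𝕍) 1 → 𝕍) (discCapMap n (bX.incl z))
        (mfderiv (𝓡 n) (𝓡 (n + 1)) (discCapMap n ∘ bX.incl) z w)⟫ = 0 := by
  rw [mvfderiv_coe_mfderiv_discCapMap_comp_incl, inner_smul_right, inner_pole_capEmb, mul_zero]

/-- **The boundary of the ball is a spacelike immersion into the round sphere** under `Φ ∘ incl`
(all differentials injective, round metric Riemannian). [folklore] -/
theorem isSpacelikeImmersion_discCapMap_comp_incl :
    (roundMetric (n := n + 1) 𝕍).IsSpacelikeImmersion (𝓡 n) (discCapMap n ∘ bX.incl) := by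
  refine ⟨contMDiff_discCapMap_comp_incl bX, fun z w hw ↦ ?_⟩
  rw [PseudoRiemannianMetric.inducedBilin_apply]
  refine isRiemannian_roundMetric _ _ fun h0 ↦ hw ?_
  have h1 : bdryVec bX z w = 0 := mfderiv_capMap_injective (n := n) (spherePole n) _
    ((mfderiv_discCapMap_comp_incl bX z w).symm.trans (h0.trans (map_zero _).symm))
  have h2 : mfderiv (𝓡 n) (𝓡∂ (n + 1)) bX.incl z w = 0 :=
    (closedBallCoeDeriv (bX.incl z)).injective (h1.trans (map_zero _).symm)
  exact boundaryData_mfderiv_incl_injective bX z (h2.trans (map_zero _).symm)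

/-- **The outward normal of the ball's boundary in the cap picture**: the radial field of the
caps along `Φ ∘ incl`. [folklore] -/
def discNormal : NormalField (𝓡 (n + 1)) (discCapMap n ∘ bX.incl) := fun z ↦
  capNormal (n := n) (spherePole n) (discCapMap n (bX.incl z))

/-- Unfolding lemma for `discNormal`. [folklore] -/
theorem discNormal_apply (z : bX.carrier) :
    discNormal bX z = capNormal (n := n) (spherePole n) (discCapMap n (bX.incl z)) := rfl

/-- Read in `ℝⁿ⁺²`, the normal at `Φ(x)`, `‖x‖ = 1`, is `2ρ⁻³ (e x + e₀)`. [folklore] -/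
theorem mvfderiv_coe_discNormal (z : bX.carrier) :
    mvfderiv (𝓡 (n + 1)) (Subtype.val : sphere (0 : 𝕍) 1 → 𝕍) (discCapMap n (bX.incl z))
        (discNormal bX z) =
      (2 * (capRadius (n := n) ((bX.incl z : 𝔻) : EuclideanSpace ℝ (Fin (n + 1))))⁻¹ ^ 3) •
        (capEmb (spherePole n) ((bX.incl z : 𝔻) : EuclideanSpace ℝ (Fin (n + 1))) +
          ((spherePole n : sphere (0 : 𝕍) 1) : 𝕍)) := by
  rw [discNormal_apply, discCapMap_apply, mvfderiv_coe_capNormal_capMap, capField_capMapAmb,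
    norm_coe_boundaryData_incl, one_pow, one_smul]

/-- **It is a unit normal field** for the round metric: orthogonal to `dι d(Φ ∘ incl) w = ρ⁻¹ e ξ`
as `⟪e x + e₀, e ξ⟫ = ⟪x, ξ⟫ = 0`, and of length `(2ρ⁻³)² · 2 = 1` as `ρ² = 2`. [folklore] -/
theorem isUnitNormal_discNormal :
    (roundMetric (n := n + 1) 𝕍).IsUnitNormal (𝓡 n) (discCapMap n ∘ bX.incl) (discNormal bX) 1 := by
  refine ⟨fun z w ↦ ?_, fun z ↦ ?_⟩
  · change (roundMetric (n := n + 1) 𝕍).val (discCapMap n (bX.incl z)) (discNormal bX z)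
      (mfderiv (𝓡 n) (𝓡 (n + 1)) (discCapMap n ∘ bX.incl) z w) = 0
    rw [roundMetric_val_eq_inner, mvfderiv_coe_discNormal, mvfderiv_coe_mfderiv_discCapMap_comp_incl,
      inner_smul_left, inner_smul_right, inner_add_left, inner_capEmb_capEmb, inner_pole_capEmb,
      inner_coe_incl_bdryVec]
    simp
  · change (roundMetric (n := n + 1) 𝕍).val (discCapMap n (bX.incl z)) (discNormal bX z)
      (discNormal bX z) = 1
    rw [roundMetric_val_eq_inner, mvfderiv_coe_discNormal, real_inner_self_eq_norm_sq, norm_smul,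
      mul_pow, norm_add_sq_real, norm_capEmb, inner_capEmb_pole, norm_eq_of_mem_sphere (spherePole n),
      norm_coe_boundaryData_incl,
      Real.norm_eq_abs, sq_abs]
    linear_combination (8 * ((capRadius (n := n) ((bX.incl z : 𝔻) :
      EuclideanSpace ℝ (Fin (n + 1))))⁻¹ ^ 2) ^ 2 + 4 * (capRadius (n := n) ((bX.incl z : 𝔻) :
        EuclideanSpace ℝ (Fin (n + 1))))⁻¹ ^ 2 + 2) * inv_capRadius_incl_sq bX z

/-- The normal field is smooth along the boundary. [folklore] -/
theorem contMDiff_discNormal : ContMDiff (𝓡 n) (𝓡 (n + 1)).tangent ∞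
    (fun z ↦ (TotalSpace.mk' (EuclideanSpace ℝ (Fin (n + 1))) (discCapMap n (bX.incl z))
      (discNormal bX z) : TangentBundle (𝓡 (n + 1)) (sphere (0 : 𝕍) 1))) := fun z ↦
  (contMDiffAt_capNormal (spherePole n) (inner_pole_discCapMap_neg (bX.incl z))).comp z
    (contMDiff_discCapMap_comp_incl bX z)

/-- **The normal points out of the ball**: its preimage under `dΦ` is `(Dι)⁻¹ (2x)`, … [folklore] -/
theorem inverse_mfderiv_discNormal (z : bX.carrier) :
    (mfderiv (𝓡∂ (n + 1)) (𝓡 (n + 1)) (discCapMap n) (bX.incl z)).inverse (discNormal bX z) =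
      (closedBallCoeDeriv (bX.incl z)).symm
        ((2 : ℝ) • ((bX.incl z : 𝔻) : EuclideanSpace ℝ (Fin (n + 1)))) := by
  have hu : discNormal bX z = mfderiv (𝓡∂ (n + 1)) (𝓡 (n + 1)) (discCapMap n) (bX.incl z)
      ((closedBallCoeDeriv (bX.incl z)).symm
        ((2 : ℝ) • ((bX.incl z : 𝔻) : EuclideanSpace ℝ (Fin (n + 1))))) := by
    rw [mfderiv_discCapMap_apply, ContinuousLinearEquiv.apply_symm_apply]
    exact capNormal_capMap (spherePole n) _
  rw [hu, (isInvertible_mfderiv_discCapMap n _).inverse_apply_self]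

/-- … whose `0`-th boundary-chart coordinate is `-⟪x, 2x⟫ = -2 < 0`. [folklore] -/
theorem closedBallCoeDeriv_symm_two_smul_apply_zero (z : bX.carrier) :
    ((closedBallCoeDeriv (bX.incl z)).symm
      ((2 : ℝ) • ((bX.incl z : 𝔻) : EuclideanSpace ℝ (Fin (n + 1))))) 0 < 0 := by
  rw [closedBallCoeDeriv_symm_apply_zero n (norm_coe_boundaryData_incl bX z), inner_smul_right,
    real_inner_self_eq_norm_sq, norm_coe_boundaryData_incl]
  norm_num

/-- **The boundary sphere is umbilic with `K = g`**: `D_w ν = ∇_{d(Φ∘incl) w} N = 2⟪e₀, y⟫² d(Φ∘incl) w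
= d(Φ∘incl) w` (since `2⟪e₀, y⟫² = 2ρ⁻² = 1` on `‖x‖ = 1`). [folklore] -/
theorem normalDerivAlong_discNormal [(roundMetric (n := n + 1) 𝕍).HasLeviCivita] (z : bX.carrier)
    (w : TangentSpace (𝓡 n) z) :
    (roundMetric (n := n + 1) 𝕍).normalDerivAlong (discCapMap n ∘ bX.incl) (discNormal bX) z w =
      mfderiv (𝓡 n) (𝓡 (n + 1)) (discCapMap n ∘ bX.incl) z w := by
  have h1 := normalDerivAlong_comp_eq_leviCivita (roundMetric (n := n + 1) 𝕍)
    (f := discCapMap n ∘ bX.incl) (Y := capNormal (n := n) (spherePole n)) (y := z)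
    BoundarylessManifold.isInteriorPoint ((contMDiff_discCapMap_comp_incl bX z).mdifferentiableAt
      (by simp)) ((contMDiffAt_capNormal (spherePole n)
        (inner_pole_discCapMap_neg (bX.incl z))).mdifferentiableAt (by simp)) w
  have h2 := leviCivita_capNormal (n := n) (spherePole n) (inner_pole_discCapMap_neg (bX.incl z)) _
    (inner_pole_mvfderiv_coe_mfderiv_discCapMap_comp_incl bX z w)
  change _ = (roundMetric (n := n + 1) 𝕍).leviCivita (capNormal (n := n) (spherePole n))
    (discCapMap n (bX.incl z)) (mfderiv (𝓡 n) (𝓡 (n + 1)) (discCapMap n ∘ bX.incl) z w) at h1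
  change (roundMetric (n := n + 1) 𝕍).normalDerivAlong (discCapMap n ∘ bX.incl)
    (fun z ↦ capNormal (n := n) (spherePole n) ((discCapMap n ∘ bX.incl) z)) z w = _
  rw [h1, h2, discCapMap_apply, coe_capMap, inner_pole_capMapAmb, neg_sq, inv_capRadius_incl_sq,
    mul_one_div_cancel two_ne_zero, one_smul]

/-- Hence the second fundamental form of the boundary is the induced metric … [folklore] -/
theorem secondFundamentalForm_discNormal [(roundMetric (n := n + 1) 𝕍).HasLeviCivita] (z : bX.carrier) :
    (roundMetric (n := n + 1) 𝕍).secondFundamentalForm (𝓡 n) (discCapMap n ∘ bX.incl) (discNormal bX) z =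
      ((roundMetric (n := n + 1) 𝕍).inducedMetric (discCapMap n ∘ bX.incl)
        PseudoRiemannianMetric.contMDiff_pullbackBilin_holds
        (isSpacelikeImmersion_discCapMap_comp_incl bX)).toBilinForm z := by
  refine LinearMap.ext fun w₁ ↦ LinearMap.ext fun w₂ ↦ ?_
  rw [PseudoRiemannianMetric.secondFundamentalForm_apply_holds (f := discCapMap n ∘ bX.incl)
    BoundarylessManifold.isInteriorPoint ((contMDiff_discNormal bX z).mdifferentiableAt (by simp)) w₁ w₂,
    normalDerivAlong_discNormal,
    PseudoRiemannianMetric.toBilinForm_apply, PseudoRiemannianMetric.inducedMetric_val,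
    PseudoRiemannianMetric.inducedBilin_apply]

/-- … and **its mean curvature is `H = n`** (`= n · cot(π/4)`; the metric trace of the metric is
the dimension). [folklore] -/
theorem meanCurvature_discNormal [(roundMetric (n := n + 1) 𝕍).HasLeviCivita] (z : bX.carrier) :
    (roundMetric (n := n + 1) 𝕍).meanCurvature (discCapMap n ∘ bX.incl)
      PseudoRiemannianMetric.contMDiff_pullbackBilin_holds
      (isSpacelikeImmersion_discCapMap_comp_incl bX) (discNormal bX) z = n := by
  rw [PseudoRiemannianMetric.meanCurvature, secondFundamentalForm_discNormal,
    PseudoRiemannianMetric.trace_toBilinForm_eq, finrank_euclideanSpace_fin]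

variable (n) in
/-- **The closed ball `𝔻ⁿ⁺¹` carries a Riemannian metric of positive scalar curvature with
mean-convex boundary** — Sweeney 2026, Prop. 1.2 for the simplest compact contractible manifold
`X = 𝔻ⁿ⁺¹` (`n ≥ 1`), with the full conclusion of the named fact
`Literature.Geometry.Riemannian.Sweeney2026_pscMeanConvex` for an ARBITRARY boundary datum `bX` of
`𝔻ⁿ⁺¹`: the pullback of the round metric of `Sⁿ⁺¹` along the disc-to-cap map (onto the closed
spherical cap of angular radius `π/4`, whose boundary sphere is umbilic with mean curvature
`H = n · cot(π/4) = n > 0` for the outward normal), by `pscMeanConvex_of_sphereImmersion`. This is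
the base case (`0`-handles = small geodesic balls) of Lawson–Michelsohn's handle induction behind
Prop. 1.2, and the entire geometric content of its case `n = 2` (`X³` compact contractible, hence
`X ≅ 𝔻³` by Perelman). [cite: Sweeney2026, Prop. 1.2] -/
theorem pscMeanConvex_closedBall (hn : 1 ≤ n) (bX : BoundaryData (𝓡∂ (n + 1)) 𝔻 (𝓡 n)) :
    ∃ g : PseudoRiemannianMetric (𝓡∂ (n + 1)) ∞ (EuclideanSpace ℝ (Fin (n + 1)))
        (TangentSpace (𝓡∂ (n + 1)) : 𝔻 → Type _),
    ∃ _ : g.HasLeviCivita, ∃ hf : g.IsSpacelikeImmersion (𝓡 n) bX.incl,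
    ∃ ν : NormalField (𝓡∂ (n + 1)) bX.incl,
      g.IsRiemannian ∧ (∀ x, 0 < g.scalarCurvature x) ∧ g.IsUnitNormal (𝓡 n) bX.incl ν 1 ∧
      ContMDiff (𝓡 n) (𝓡∂ (n + 1)).tangent ∞
        (fun z ↦ (TotalSpace.mk' (EuclideanSpace ℝ (Fin (n + 1))) (bX.incl z) (ν z) :
          TangentBundle (𝓡∂ (n + 1)) 𝔻)) ∧
      (∀ z, (show EuclideanSpace ℝ (Fin (n + 1)) from ν z) 0 < 0) ∧
      ∀ z, 0 < g.meanCurvature bX.incl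
        PseudoRiemannianMetric.contMDiff_pullbackBilin_holds hf ν z := by
  haveI : (roundMetric (n := n + 1) 𝕍).HasLeviCivita := (roundMetric (n := n + 1) 𝕍).hasLeviCivita
  have hout : ∀ z, (show EuclideanSpace ℝ (Fin (n + 1)) from
      (mfderiv (𝓡∂ (n + 1)) (𝓡 (n + 1)) (discCapMap n) (bX.incl z)).inverse (discNormal bX z)) 0 < 0 :=
    fun z ↦ by
    have h := closedBallCoeDeriv_symm_two_smul_apply_zero bX z
    rw [← inverse_mfderiv_discNormal bX z] at h
    exact h
  exact pscMeanConvex_of_sphereImmersion n hn _ bX 𝕍 (contMDiff_discCapMap n)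
    (mfderiv_discCapMap_injective n) (isSpacelikeImmersion_discCapMap_comp_incl bX)
    (isUnitNormal_discNormal bX) (contMDiff_discNormal bX) hout fun z ↦ by
    rw [meanCurvature_discNormal bX z]; exact_mod_cast hn

end Disc

end Literature.Geometry.Riemannian

end
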